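import Mathlib
import Literature.NumberTheory.Automorphic.CuspidalPeterssonForm
import Literature.NumberTheory.Automorphic.AutomorphicLieDerivSkewAdjointArchGrowth
import HarnessLib

/-!
# Borel's integration by parts against the twisted cusp forms of a unitary twist —
crux `HeckeEigenvalueField` (stmt-Langlands-13632), line `Sketch`, stub END-SCALAR, part BOREL

Namespace `Summit.Langlands.Langlands.Theorems.HeckeEigenvalueField.Res`.  Theorems only (no preamble).

* `integrable_mul_conj_of_archModerateGrowth` — a continuous function on `GL_n(𝔸_K) ⧸ A_G GL_n(K)` whose
  inversion has moderate growth in the archimedean height, locally uniformly in the finite variable,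
  times the conjugate of a cusp form is integrable for every automorphic measure (Siegel domination, the
  weight of `exists_weight_of_archModerateGrowth`, rapid decay: `integrable_weight_mul_norm_of_le_on_siegelSet`;
  adapted from the `n = 2` version of `GL2CESHNonvanishing`);
* `stub_endScalar_borel` (registered sub-stub) — for `Φ` left `A_G GL_n(K)`-invariant, continuous,
  arch-smooth, of such growth together with `X Φ`, and `X ∈ 𝔤` of norm exponent zero: integrability of
  `Φ↓ · conj (T.form y)` and of `(X Φ)↓ · conj (T.form y)`, and
  `∫ (X Φ)↓ conj (T.form y) dμ = -∫ Φ↓ conj (T.form (X y)) dμ` for the twisted forms `T.form y` of a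
  unitary twist `T` of an automorphic representation `π` (the tree's
  `integral_descend_lieDeriv_mul_conj_cuspFormsGL_eq_neg_of_archModerateGrowth`; the twist `|det|_𝔸^s`
  commutes with `X`, `AutomorphicRepData.lieDeriv_mulChar_detTwist_of_cpow`).

References: A. Borel, *Automorphic forms on SL₂(ℝ)* (1997), 11.12 (2) [Borel1997]; G. Harder, Invent.
Math. 89 (1987), §3.1 [Harder1987]; C. Moeglin, J.-L. Waldspurger (1995), I.2.2 [MoeglinWaldspurger1995].
-/

set_option linter.dupNamespace false -- project-wide: `Summit.Langlands.Langlands` is the mandated namespace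

noncomputable section

open scoped Classical Matrix ComplexConjugate NNReal Pointwise
open Filter NumberField NumberField.mixedEmbedding IsDedekindDomain Set Literature.NumberTheory.Automorphic
open _root_.MeasureTheory _root_.MeasureTheory.Measure

namespace Summit.Langlands.Langlands.Theorems.HeckeEigenvalueField.Res

variable {n : ℕ} {K : Type} [Field K] [NumberField K] {hcpt : isCompact_glFiniteIntegralLevel n K}

-- adapted from `GL2CESHNonvanishing.integrable_conj_mul_cuspFormsGL` (there for `n = 2`)
/-- **A continuous function of archimedean moderate growth (locally uniformly in the finite variable)
times the conjugate of a cusp form is integrable on the automorphic quotient** (Siegel domination of the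
automorphic measure, the weight of `exists_weight_of_archModerateGrowth`, rapid decay of cusp forms).
[cite: Borel1997, 11.12] [cite: MoeglinWaldspurger1995, I.2.2] -/
theorem integrable_mul_conj_of_archModerateGrowth [NeZero n]
    {μ : Measure (AdelicGroupData.gl n K).automorphicQuotient} [(AdelicGroupData.gl n K).IsAutomorphicMeasure μ]
    {f g : (AdelicGroupData.gl n K).automorphicQuotient → ℂ} (hfc : Continuous f)
    (hfm : ∀ C : Set (GL (Fin n) (FiniteAdeleRing (𝓞 K) K)), IsCompact C →
      ∃ (A : ℝ) (r : ℕ), ∀ g' : (AdelicGroupData.gl n K).Adelic, GLn.sndHom n K g' ∈ C →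
        ‖invQuot (AdelicGroupData.gl n K) f g'‖ ≤ A * (1 ⊔ (GLn.archHeight n K g' : ℝ)) ^ r)
    (hg : invQuot (AdelicGroupData.gl n K) g ∈ cuspFormsGL n K hcpt) :
    Integrable (fun y => f y * conj (g y)) μ := by
  have hn : 0 < n := Nat.pos_of_ne_zero (NeZero.ne n)
  letI : MeasurableSpace (GL (Fin n) (AdeleRing (𝓞 K) K)) := borel _
  haveI : BorelSpace (GL (Fin n) (AdeleRing (𝓞 K) K)) := ⟨rfl⟩
  haveI : T2Space (GL (Fin n) (AdeleRing (𝓞 K) K)) := t2Space_gl n K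
  haveI : LocallyCompactSpace (GL (Fin n) (AdeleRing (𝓞 K) K)) :=
    AdelicGroupData.locallyCompactSpace_generalLinearGroup_adeleRing K (Fin n)
  set μG : Measure (GL (Fin n) (AdeleRing (𝓞 K) K)) := haar with hμG
  obtain ⟨c, Ω, t, Z, hc, ht, hΩc, hΩB, hZc, hZ, hle⟩ :=
    exists_lintegral_le_mul_setLIntegral_siegel n K μ μG
  set Cf : Set (GL (Fin n) (FiniteAdeleRing (𝓞 K) K)) := GLn.sndHom n K '' Ω *
    (glFiniteIntegralLevel n K : Set (GL (Fin n) (FiniteAdeleRing (𝓞 K) K))) with hCf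
  have hCfc : IsCompact Cf := isCompact_sndHom_image_mul_glFiniteIntegralLevel hcpt hΩc
  obtain ⟨w, Cst, R, hwc, hw0, hwf, -, hwle⟩ :=
    exists_weight_of_archModerateGrowth (hcpt := hcpt) hn (0 : (AutomorphyDatum.gl n K hcpt).arch.lie)
      hfc hfc (hfm Cf hCfc) (hfm Cf hCfc)
  have hwS : ∀ x ∈ Z * (Ω * siegelCone n K t *
      (standardMaximalCompactGL n K : Set (GL (Fin n) (AdeleRing (𝓞 K) K)))),
      w ((AdelicGroupData.gl n K).toAutomorphicQuotient x⁻¹) ≤ Cst * (1 ⊔ adelicHeightGL n K x) ^ R :=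
    fun x hx ↦ hwle x (sndHom_mem_of_mem_mul_siegelSet hZ hx)
  -- the cusp-form side
  have hAG : ∀ z ∈ (AdelicGroupData.gl n K).center', ∀ x,
      invQuot (AdelicGroupData.gl n K) g (z * x) = invQuot (AdelicGroupData.gl n K) g x :=
    fun _ hz x ↦ invQuot_mul_left (AdelicGroupData.gl n K) g ((AdelicGroupData.gl n K).center'_le_quotientSubgroup hz) x
  have hgc : Continuous (invQuot (AdelicGroupData.gl n K) g) :=
    continuous_of_mem_automorphicForms_gl (cuspFormsGL_le_automorphicForms n K hcpt hg)
  have hgrd : IsRapidlyDecreasingGL n K (invQuot (AdelicGroupData.gl n K) g) :=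
    (isCuspFormGL_of_mem_cuspFormsGL' hg).isRapidlyDecreasingGL_of_center' hAG
  have hint : Integrable (fun y => w y * ‖g y‖) μ :=
    integrable_weight_mul_norm_of_le_on_siegelSet hn μG hc hΩc hΩB ht hZc hZ hle hwc hw0 hwS hgc hgrd
  -- `|f| ≤ w`
  have hfw : ∀ y, ‖f y‖ ≤ w y := fun y => by
    have := hwf 0 (by norm_num) y
    rwa [zero_smul, RealMatrixGroup.expMem_zero', map_one, one_smul] at this
  have hgq : Continuous g := continuous_of_continuous_invQuot hgc
  refine hint.mono' (hfc.mul (Complex.continuous_conj.comp hgq)).aestronglyMeasurable (ae_of_all _ fun y => ?_)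
  rw [norm_mul, Complex.norm_conj]
  exact mul_le_mul_of_nonneg_right (hfw y) (norm_nonneg _)

/-- Descents of equal functions are equal. [folklore] -/
theorem descend_congr' {φ ψ : (AdelicGroupData.gl n K).Adelic → ℂ} (h : φ = ψ)
    (hφ : ∀ γ ∈ (AdelicGroupData.gl n K).quotientSubgroup, ∀ x, φ (γ * x) = φ x)
    (hψ : ∀ γ ∈ (AdelicGroupData.gl n K).quotientSubgroup, ∀ x, ψ (γ * x) = ψ x) :
    (AdelicGroupData.gl n K).descend φ hφ = (AdelicGroupData.gl n K).descend ψ hψ := by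
  subst h
  rfl

set_option maxHeartbeats 400000 in
-- the statement elaborates the datum-typed Borel hypotheses and the twisted cusp forms
/-- **Stub END-SCALAR, part BOREL — Borel's integration by parts against the twisted cusp forms of a
unitary twist, with integrability.**  For `Φ` on `GL_n(𝔸_K)` left invariant under `A_G GL_n(K)`,
continuous, smooth in the archimedean variable, of moderate growth in `H_∞` locally uniformly in the
finite variable, with `X Φ` continuous of the same growth, and `X ∈ 𝔤` of norm exponent zero: both
`Φ↓ · conj (T.form y)` and `(X Φ)↓ · conj (T.form y)` are integrable for the automorphic measure, and
`∫ (X Φ)↓ conj (T.form y) dμ = -∫ Φ↓ conj (T.form (X y)) dμ` (tree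
`integral_descend_lieDeriv_mul_conj_cuspFormsGL_eq_neg_of_archModerateGrowth`; the twist `|det|^s`
commutes with `X`, `lieDeriv_mulChar_detTwist_of_cpow`). [cite: Borel1997, 11.12 (2)]
[cite: Harder1987, §3.1] -/
theorem stub_endScalar_borel {n : ℕ} {K : Type} [Field K] [NumberField K] [NeZero n]
    {hcpt : isCompact_glFiniteIntegralLevel n K} {π : AutomorphicRepData (AutomorphyDatum.gl n K hcpt)}
    (T : π.UnitaryTwist) (μ : Measure (AdelicGroupData.gl n K).automorphicQuotient)
    [(AdelicGroupData.gl n K).IsAutomorphicMeasure μ]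
    (X : (AutomorphyDatum.gl n K hcpt).arch.lie)
    (hX : ((∑ w, (X : Matrix (Fin n) (Fin n) (mixedSpace K)).trace.1 w) +
      ∑ w, 2 * ((X : Matrix (Fin n) (Fin n) (mixedSpace K)).trace.2 w).re) = 0)
    {Φ : (AdelicGroupData.gl n K).Adelic → ℂ}
    (hΦinv : ∀ γ ∈ (AdelicGroupData.gl n K).quotientSubgroup, ∀ x, Φ (γ * x) = Φ x)
    (hΦc : Continuous Φ) (hΦs : IsArchSmooth (AutomorphyDatum.gl n K hcpt).ofArch Φ)
    (hΦm : ∀ C : Set (GL (Fin n) (FiniteAdeleRing (𝓞 K) K)), IsCompact C →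
      ∃ (A : ℝ) (r : ℕ), ∀ g' : (AdelicGroupData.gl n K).Adelic, GLn.sndHom n K g' ∈ C →
        ‖Φ g'‖ ≤ A * (1 ⊔ (GLn.archHeight n K g' : ℝ)) ^ r)
    (hΦXc : Continuous (lieDeriv (AutomorphyDatum.gl n K hcpt).ofArch X Φ))
    (hΦXm : ∀ C : Set (GL (Fin n) (FiniteAdeleRing (𝓞 K) K)), IsCompact C →
      ∃ (A : ℝ) (r : ℕ), ∀ g' : (AdelicGroupData.gl n K).Adelic, GLn.sndHom n K g' ∈ C →
        ‖lieDeriv (AutomorphyDatum.gl n K hcpt).ofArch X Φ g'‖ ≤ A * (1 ⊔ (GLn.archHeight n K g' : ℝ)) ^ r)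
    (y : π.W) :
    Integrable (fun x => (AdelicGroupData.gl n K).descend Φ hΦinv x * conj (T.form y x)) μ ∧
    Integrable (fun x => (AdelicGroupData.gl n K).descend (lieDeriv (AutomorphyDatum.gl n K hcpt).ofArch X Φ)
      (lieDeriv_apply_mul_of_forall_apply_mul (AutomorphyDatum.gl n K hcpt) hΦinv X) x * conj (T.form y x)) μ ∧
    ∫ x, (AdelicGroupData.gl n K).descend (lieDeriv (AutomorphyDatum.gl n K hcpt).ofArch X Φ)
        (lieDeriv_apply_mul_of_forall_apply_mul (AutomorphyDatum.gl n K hcpt) hΦinv X) x * conj (T.form y x) ∂μ =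
      -∫ x, (AdelicGroupData.gl n K).descend Φ hΦinv x * conj (T.form (π.lieDerivW X y) x) ∂μ := by
  have hn : 0 < n := Nat.pos_of_ne_zero (NeZero.ne n)
  -- integrability
  have hint : ∀ {Ψ : (AdelicGroupData.gl n K).Adelic → ℂ}
      (hΨinv : ∀ γ ∈ (AdelicGroupData.gl n K).quotientSubgroup, ∀ x, Ψ (γ * x) = Ψ x),
      Continuous Ψ →
      (∀ C : Set (GL (Fin n) (FiniteAdeleRing (𝓞 K) K)), IsCompact C →
        ∃ (A : ℝ) (r : ℕ), ∀ g' : (AdelicGroupData.gl n K).Adelic, GLn.sndHom n K g' ∈ C →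
          ‖Ψ g'‖ ≤ A * (1 ⊔ (GLn.archHeight n K g' : ℝ)) ^ r) → ∀ z : π.W,
      Integrable (fun x => (AdelicGroupData.gl n K).descend Ψ hΨinv x * conj (T.form z x)) μ := by
    intro Ψ hΨinv hΨc hΨm z
    refine integrable_mul_conj_of_archModerateGrowth (hcpt := hcpt) ?_ ?_ (T.invQuot_form_mem z)
    · exact continuous_of_continuous_invQuot (by rwa [AdelicGroupData.invQuot_descend])
    · simpa only [AdelicGroupData.invQuot_descend] using hΨm
  refine ⟨hint hΦinv hΦc hΦm y, hint _ hΦXc hΦXm y, ?_⟩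
  -- the twist commutes with `X`
  obtain ⟨lam, -, hlam⟩ := exists_normExponent (n := n) (K := K) hcpt
  have hlamX : lam X = 0 := by rw [hlam, hX]
  have hφ : mulChar (detTwist n T.χ) (y : (AdelicGroupData.gl n K).Adelic → ℂ) ∈ cuspFormsGL n K hcpt := T.cusp y y.2
  have hφA : ∀ z ∈ (AdelicGroupData.gl n K).center', ∀ x,
      mulChar (detTwist n T.χ) (y : (AdelicGroupData.gl n K).Adelic → ℂ) (z * x) =
        mulChar (detTwist n T.χ) (y : (AdelicGroupData.gl n K).Adelic → ℂ) x :=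
    fun z hz x => T.inv y y.2 z ((AdelicGroupData.gl n K).center'_le_quotientSubgroup hz) x
  have key := integral_descend_lieDeriv_mul_conj_cuspFormsGL_eq_neg_of_archModerateGrowth (μ := μ) hn X hΦinv hΦc
    hΦs hΦm hΦXc hΦXm hφ hφA
  have hder : lieDeriv (AutomorphyDatum.gl n K hcpt).ofArch X
      (mulChar (detTwist n T.χ) (y : (AdelicGroupData.gl n K).Adelic → ℂ)) =
      mulChar (detTwist n T.χ) ((π.lieDerivW X y : π.W) : (AdelicGroupData.gl n K).Adelic → ℂ) := by
    rw [π.lieDeriv_mulChar_detTwist_of_cpow T.hχ hlam X y, hlamX, Complex.ofReal_zero, mul_zero, zero_smul,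
      add_zero]
  have e1 : (AdelicGroupData.gl n K).descend (mulChar (detTwist n T.χ) (y : (AdelicGroupData.gl n K).Adelic → ℂ))
      ((AdelicGroupData.gl n K).leftInvariant_quotientSubgroup
        (isLeftInvariant_of_mem_automorphicForms (cuspFormsGL_le_automorphicForms n K hcpt hφ)) hφA) = T.form y :=
    rfl
  have e2 : (AdelicGroupData.gl n K).descend (lieDeriv (AutomorphyDatum.gl n K hcpt).ofArch X
      (mulChar (detTwist n T.χ) (y : (AdelicGroupData.gl n K).Adelic → ℂ)))
      ((AdelicGroupData.gl n K).leftInvariant_quotientSubgroup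
        (isLeftInvariant_of_mem_automorphicForms (cuspFormsGL_le_automorphicForms n K hcpt
          ((isStableSubmodule_cuspFormsGL hcpt).lie_stable X _ hφ)))
        (lieDeriv_apply_center'_mul hφA X)) = T.form (π.lieDerivW X y) :=
    descend_congr' hder _ _
  rw [e1, e2] at key
  exact key

end Summit.Langlands.Langlands.Theorems.HeckeEigenvalueField.Res

end
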